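import Summits.HubbardSuperconductivity.HubbardSuperconductivity.Theses.ChiralWindow
import Summits.HubbardSuperconductivity.HubbardSuperconductivity.Theses.KacWindowPenalty
import Summits.HubbardSuperconductivity.HubbardSuperconductivity.Theses.AbsenceCertificate
import Summits.HubbardSuperconductivity.HubbardSuperconductivity.Theorems.WcbcsSsbToTorusLRO.Negative.FacePurityDissection
import Summits.HubbardSuperconductivity.HubbardSuperconductivity.Theorems.WcbcsSsbToTorusLRO.Negative.WindowInfraredBound1089
import Literature.MathematicalPhysics.QuantumLattice.DWaveSource
import Literature.MathematicalPhysics.QuantumLattice.HubbardGrandCanonicalDensity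

/-!
# Line `griffiths-block-slope` — lead prover's checked skeleton (v1) for crux `CwSsbToEvenTorusLRO`
(stmt-HubbardSuperconductivity-10439, route `ChiralWindow`; `Iff.rfl`-twin of `WeakCouplingBCS.WcbcsSsbToTorusLRO`,
stmt-2009). Rebuilt 2026-08-16 by prover-line-stmt-HubbardSuperconductivity-10439-0 from the registered stub
names, the tree sketch `Cruxes/CwSsbToEvenTorusLRO/SketchGriffithsBlockSlope.lean`, the idea card
`Ideas/griffiths-block-slope.md` (Transfer **B**, R-uniform form demanded by TRIAGE r1-1/2/3) and the twin's
landed Negative files, because the planner's `Lines/griffiths-block-slope.lean` was never published to the tree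
(evidence store not mounted in the lead's jail).

Crux: `∃ U₀ > 0, ∀ U ∈ Ioo 0 U₀, ∀ δ ∈ Ioo 0 (1/2), ∀ μ, DensityMatched U δ μ → HasDWaveOrder U μ → (summit
matrix at (U, δ))`.

Line (two-parameter Griffiths block slope, Transfer B). With `K_μ = hubbardTorusWith 2 L 1 U μ`,
`T_h = dWaveSourceTorus L U μ h = K_μ − h(P + Pᴴ)`, `P = pairField dWaveFormFactor L`, the Kac block operator
`W_R = R⁻⁴ Σ_a B_aᴴ B_a`, `B_a = Σ_{u ∈ [0,R)²} P_{a+u}` (convention of the landed Fejér closure), and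
`E_L(h, κ) = E₀(T_h + κ W_R)`:

* `stub_blockSlope` (S1, finite `L`, provable now): `E_L(h, κ−t) − E_L(h, κ) ≤ −t (Re ω_{h,κ}(P))² / L²`
  for `t ≥ 0` — the variational chord with the tracial ground state of `T_h + κW_R` plus
  `Re ω(W_R) ≥ (Re ω(P))²/L²` (`Σ_a B_a = R²P`, Cauchy–Schwarz twice).
* `stub_repelledOrderPersistence` (S2, OPEN, hardest, held by the lead): under the crux hypotheses there is a
  floor `a > 0` such that for EVERY block scale `R` some repulsive coupling `κ = κ(R) > 0` keeps Koma–Tasaki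
  d-wave order `≥ a` in the REPELLED model `K_μ + κ W_R` (sourced, `L → ∞` first, all small `h`) — the
  R-uniform form of the card's (B) (`OrderLscBlock` of the merged card `block-slope-transport`).
* `stub_canonicalSupportingPotential` (S3 = item stmt-HubbardSuperconductivity-9491
  `AbsenceCertificate.CanonicalSupportingPotential`, VERBATIM; T = 0 equivalence of ensembles at SOME `μ′`):
  with density matching it gives canonical/GC equivalence at the crux's own `μ` by Griffiths recentring
  (`canonicalGCEquivalence_of_csp_of_densityMatched`, adapted from the twin line
  `Cruxes/WcbcsSsbToTorusLRO/Lines/quenched-corner-by-square-completion.lean` §1).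
* `stub_sourceRemoval` (S4, finite `L`, provable now, Weyl): `|E₀(T_h + κW_R) − E₀(K_μ + κW_R)| ≤ 12|h|L²`
  (`‖P + Pᴴ‖ ≤ 2‖P‖ ≤ 8√2 L² ≤ 12 L²`, `norm_pairField_le`).
* `stub_sectorFloorGC` (S5, finite `L`, provable now): `E₀(K_μ + κW_R) ≤ E_sec(H + κW_R)(N, S^z=0) − μN`
  (unit sector vectors are trial vectors; `N̂ = N` on the sector).
* COMPOSITION (sorry-free): S1+S2+S4+S5 + CGE ⇒ the CHORD form of face purity at every guarded `(U, δ, μ)` with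
  floor `a²/4` (`facePurityChord_of_stubs`; real bookkeeping `repelled_chord_arith`); then VERBATIM the twin's
  landed dissection: `deriv_of_chord`, `leak_of_windowInfraredBound` (item stmt-1089
  `KacWindowPenalty.WindowInfraredBound`, admissible hypothesis BY NAME, as in both twin lines),
  `floor_of_deriv_of_leak` (landed Fejér closure), `hasDWavePairFieldLROAt_of_floor`; the conclusion is the crux
  BY NAME (`CwSsbToEvenTorusLRO_of`), its body being `HasDWavePairFieldLROAt U δ` definitionally.

Disproof used (`Cruxes/CwSsbToEvenTorusLRO/Disproof.lean`, gen 2 cycle-2 boundary 2): §1 (no `_false_without_`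
theorem for either hypothesis; both are consumed inside S2, DM also in the recentring); §2 (the uniform crux shape is
kept — `_of` concludes the crux BY NAME; `TransferOnWindow` is the documented fallback, every stub is pointwise in
`(U, δ, μ)`); §3/§3b (hazard = first-order upper coexistence edge; sits inside S2 only); §4a (`crux_of_guarded`:
S2 is a GuardedShape); §4b/§4c (NoBlockKink encoding — not used, this is Transfer B; guards `0 < R` kept: `W_0 = 0`);
§5 (`toyOrder_repelled_pos`: (B) holds at mean field for `κ < g_eff`); §6 no targets yet.
-/

noncomputable section

set_option linter.dupNamespace false

namespace Summit.HubbardSuperconductivity.HubbardSuperconductivity.Cruxes.CwSsbToEvenTorusLRO.GriffithsBlockSlope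

open Literature.MathematicalPhysics.QuantumLattice Literature.Barriers.HubbardSuperconductivity
open Summit.HubbardSuperconductivity.WcbcsSsbToTorusLRO.Negative
open Filter Set Matrix
open scoped Matrix ComplexOrder BigOperators
open _root_.Topology

/-! ## The registered stubs -/

/-- **Stub S1 — two-parameter Griffiths block slope at a repelled base point (finite `L`, provable now).**
On the attractive side of the base point `κ` the block perturbation lowers the SOURCED ground energy at rate
at least the squared sourced pair amplitude of the base Hamiltonian:
`E₀(T_h + (κ−t)W_R) − E₀(T_h + κW_R) ≤ −t (Re ω_{T_h+κW_R}(P))²/L²`, `t ≥ 0`, `R ≥ 1`. -/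
theorem stub_blockSlope :
    ∀ (L : ℕ) [NeZero L] (R : ℕ), 0 < R → ∀ (U μ h κ t : ℝ), 0 ≤ t →
      (dWaveSourceTorus L U μ h + ((κ - t : ℝ) : ℂ) • (((((R : ℝ) ^ 4)⁻¹ : ℝ) : ℂ) • ∑ a : Literature.Probability.LatticeModels.TorusSite 2 L, (∑ u : Fin 2 → Fin R, localPair dWaveFormFactor L (a + fun i => ((u i : ℕ) : ZMod L)))ᴴ * (∑ u : Fin 2 → Fin R, localPair dWaveFormFactor L (a + fun i => ((u i : ℕ) : ZMod L))))).groundEnergy -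
          (dWaveSourceTorus L U μ h + (κ : ℂ) • (((((R : ℝ) ^ 4)⁻¹ : ℝ) : ℂ) • ∑ a : Literature.Probability.LatticeModels.TorusSite 2 L, (∑ u : Fin 2 → Fin R, localPair dWaveFormFactor L (a + fun i => ((u i : ℕ) : ZMod L)))ᴴ * (∑ u : Fin 2 → Fin R, localPair dWaveFormFactor L (a + fun i => ((u i : ℕ) : ZMod L))))).groundEnergy ≤
        -t * ((dWaveSourceTorus L U μ h + (κ : ℂ) • (((((R : ℝ) ^ 4)⁻¹ : ℝ) : ℂ) • ∑ a : Literature.Probability.LatticeModels.TorusSite 2 L, (∑ u : Fin 2 → Fin R, localPair dWaveFormFactor L (a + fun i => ((u i : ℕ) : ZMod L)))ᴴ * (∑ u : Fin 2 → Fin R, localPair dWaveFormFactor L (a + fun i => ((u i : ℕ) : ZMod L))))).groundStateFunctional (pairField dWaveFormFactor L)).re ^ 2 / (L : ℝ) ^ 2 := by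
  sorry

/-- **Stub S2 — repelled order persistence, R-uniform floor (OPEN, hardest; held by the lead).** Under the
crux hypotheses at `(U, δ, μ)`: one floor `a > 0` such that for every block scale `R ≥ 1` there are a repulsive
block coupling `κ > 0` and a source window `(0, h₀)` on which, eventually in the side `L+1`, the sourced tracial
pair amplitude of the REPELLED model `K_μ + κ W_R − h(P+Pᴴ)` is `≥ a (L+1)²` — Koma–Tasaki d-wave order of the
block-repelled model with an `R`-uniform floor (Transfer B of the card in the R-uniform form of TRIAGE r1-3). -/
theorem stub_repelledOrderPersistence :
    ∃ U₀ : ℝ, 0 < U₀ ∧ ∀ U ∈ Set.Ioo (0:ℝ) U₀, ∀ δ ∈ Set.Ioo (0:ℝ) (1 / 2), ∀ μ : ℝ, Filter.Tendsto (fun L : ℕ => ((hubbardTorusWith 2 (L + 1) 1 U μ).groundStateFunctional totalNumber).re / ((L + 1 : ℕ) : ℝ) ^ 2) Filter.atTop (nhds (1 - δ)) → HasDWaveOrder U μ → ∃ a : ℝ, 0 < a ∧ ∀ R : ℕ, 0 < R → ∃ κ : ℝ, 0 < κ ∧ ∃ h₀ : ℝ, 0 < h₀ ∧ ∀ h ∈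 Set.Ioo (0:ℝ) h₀, ∀ᶠ L : ℕ in Filter.atTop, a ≤ ((dWaveSourceTorus (L + 1) U μ h + (κ : ℂ) • (((((R : ℝ) ^ 4)⁻¹ : ℝ) : ℂ) • ∑ a : Literature.Probability.LatticeModels.TorusSite 2 (L + 1), (∑ u : Fin 2 → Fin R, localPair dWaveFormFactor (L + 1) (a + fun i => ((u i : ℕ) : ZMod (L + 1))))ᴴ * (∑ u : Fin 2 → Fin R, localPair dWaveFormFactor (L + 1) (a + fun i => ((u i : ℕ) : ZMod (L + 1)))))).groundStateFunctional (pairField dWaveFormFactor (L + 1))).re / ((L + 1 : ℕ) : ℝ) ^ 2 := by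
  sorry

/-- **Stub S3 — canonical supporting potential** = item stmt-HubbardSuperconductivity-9491
`AbsenceCertificate.CanonicalSupportingPotential` VERBATIM (`csp_iff` below is `Iff.rfl`): T = 0 equivalence of
ensembles on the even tori at SOME chemical potential `μ′` (a subgradient of the canonical energy density at
`1 − δ`). Thermodynamic-limit work (existence and convexity of `e(ρ)` along even tori, `E₀(K_μ)/L² → −e*(μ)`). -/
theorem stub_canonicalSupportingPotential :
    ∀ (U δ : ℝ), δ ∈ Set.Ioo (0:ℝ) 1 → ∃ μ : ℝ, ∀ ε : ℝ, 0 < ε → ∃ L₀ : ℕ, ∀ L : ℕ, Even L → L₀ ≤ L → |(hubbardTorus 2 L 1 U).minEnergyOn (szSector (2 * ⌊(1 - δ) * (L : ℝ) ^ 2 / 2⌋₊) 0) - μ * ((2 * ⌊(1 - δ) * (L : ℝ) ^ 2 / 2⌋₊ : ℕ) : ℝ) - Matrix.groundEnergy (hubbardTorusWith 2 L 1 U μ)| ≤ ε * (L : ℝ) ^ 2 := by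
  sorry

/-- **Stub S4 — source removal (finite `L`, provable now; Weyl).** The sourced and source-free block-perturbed
ground energies differ by at most `‖h(P + Pᴴ)‖ ≤ 2|h|‖P‖ ≤ 8√2 |h| L² ≤ 12 |h| L²`. -/
theorem stub_sourceRemoval :
    ∀ (L : ℕ) [NeZero L] (R : ℕ) (U μ h κ : ℝ),
      |(dWaveSourceTorus L U μ h + (κ : ℂ) • (((((R : ℝ) ^ 4)⁻¹ : ℝ) : ℂ) • ∑ a : Literature.Probability.LatticeModels.TorusSite 2 L, (∑ u : Fin 2 → Fin R, localPair dWaveFormFactor L (a + fun i => ((u i : ℕ) : ZMod L)))ᴴ * (∑ u : Fin 2 → Fin R, localPair dWaveFormFactor L (a + fun i => ((u i : ℕ) : ZMod L))))).groundEnergy -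
          (hubbardTorusWith 2 L 1 U μ + (κ : ℂ) • (((((R : ℝ) ^ 4)⁻¹ : ℝ) : ℂ) • ∑ a : Literature.Probability.LatticeModels.TorusSite 2 L, (∑ u : Fin 2 → Fin R, localPair dWaveFormFactor L (a + fun i => ((u i : ℕ) : ZMod L)))ᴴ * (∑ u : Fin 2 → Fin R, localPair dWaveFormFactor L (a + fun i => ((u i : ℕ) : ZMod L))))).groundEnergy| ≤ 12 * |h| * (L : ℝ) ^ 2 := by
  sorry

/-- **Stub S5 — the sector energy dominates the grand-canonical one (finite `L`, provable now).** For a non-empty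
sector `(N, S^z = 0)`: `E₀(K_μ + κW_R) ≤ minEnergyOn (H + κW_R) (szSector N 0) − μN` (every unit vector of the
sector is a trial vector for `K_μ + κW_R = H + κW_R − μN̂`, and `N̂ = N` there). -/
theorem stub_sectorFloorGC :
    ∀ (L : ℕ) [NeZero L] (R : ℕ) (U μ κ : ℝ) (N : ℕ),
      (∃ φ : Fock (Orb (FermionTorus 2 L)), φ ∈ szSector N 0 ∧ φ ≠ 0) →
        (hubbardTorusWith 2 L 1 U μ + (κ : ℂ) • (((((R : ℝ) ^ 4)⁻¹ : ℝ) : ℂ) • ∑ a : Literature.Probability.LatticeModels.TorusSite 2 L, (∑ u : Fin 2 → Fin R, localPair dWaveFormFactor L (a + fun i => ((u i : ℕ) : ZMod L)))ᴴ * (∑ u : Fin 2 → Fin R, localPair dWaveFormFactor L (a + fun i => ((u i : ℕ) : ZMod L))))).groundEnergy ≤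
          (hubbardTorus 2 L 1 U + (κ : ℂ) • (((((R : ℝ) ^ 4)⁻¹ : ℝ) : ℂ) • ∑ a : Literature.Probability.LatticeModels.TorusSite 2 L, (∑ u : Fin 2 → Fin R, localPair dWaveFormFactor L (a + fun i => ((u i : ℕ) : ZMod L)))ᴴ * (∑ u : Fin 2 → Fin R, localPair dWaveFormFactor L (a + fun i => ((u i : ℕ) : ZMod L))))).minEnergyOn (szSector N 0) - μ * (N : ℝ) := by
  sorry

/-- S3 is literally item stmt-9491's decl. -/
theorem csp_iff :
    (∀ (U δ : ℝ), δ ∈ Set.Ioo (0:ℝ) 1 → ∃ μ : ℝ, ∀ ε : ℝ, 0 < ε → ∃ L₀ : ℕ, ∀ L : ℕ, Even L → L₀ ≤ L → |(hubbardTorus 2 L 1 U).minEnergyOn (szSector (2 * ⌊(1 - δ) * (L : ℝ) ^ 2 / 2⌋₊) 0) - μ * ((2 * ⌊(1 - δ) * (L : ℝ) ^ 2 / 2⌋₊ : ℕ) : ℝ) - Matrix.groundEnergy (hubbardTorusWith 2 L 1 U μ)| ≤ ε * (L : ℝ) ^ 2) ↔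
      Summit.HubbardSuperconductivity.HubbardSuperconductivity.Theses.AbsenceCertificate.CanonicalSupportingPotential :=
  Iff.rfl

/-! ## Canonical/GC equivalence at the crux's own `μ` from S3 + density matching (Griffiths recentring)
Adapted from the twin line `Cruxes/WcbcsSsbToTorusLRO/Lines/quenched-corner-by-square-completion.lean` §1
(prover-line-stmt-HubbardSuperconductivity-2009-1's stub-worker), verbatim up to names. -/

/-- Recentring of the canonical/GC gap in the chemical potential: for real `E, N` and all `μ, μ'`,
`E − μN − E₀(K_μ) ≤ (E − μ'N − E₀(K_{μ'})) + (μ' − μ)(N − Re ω_{K_μ}(N̂))` (supergradient inequality). -/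
theorem canonical_gc_gap_recentre (L : ℕ) (U μ μ' E N : ℝ) :
    E - μ * N - (hubbardTorusWith 2 L 1 U μ).groundEnergy ≤
      (E - μ' * N - (hubbardTorusWith 2 L 1 U μ').groundEnergy) +
        (μ' - μ) * (N - ((hubbardTorusWith 2 L 1 U μ).groundStateFunctional totalNumber).re) := by
  have h : (μ' - μ) * ((hubbardTorusWith 2 L 1 U μ).groundStateFunctional totalNumber).re ≤
      (hubbardTorusWith 2 L 1 U μ).groundEnergy - (hubbardTorusWith 2 L 1 U μ').groundEnergy := by
    have h := sub_mul_gcNumber_le (fermionTorusGraph 2 L) 1 U μ μ'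
    unfold hubbardTorusWith
    convert h
  nlinarith [h]

/-- `(1-δ)L² − 2 < N_L ≤ (1-δ)L²` for `δ ≤ 1`. -/
theorem summitNumber_mem (L : ℕ) {δ : ℝ} (hδ : δ ≤ 1) :
    (1 - δ) * (L : ℝ) ^ 2 - 2 < ((2 * ⌊(1 - δ) * (L : ℝ) ^ 2 / 2⌋₊ : ℕ) : ℝ) ∧
      ((2 * ⌊(1 - δ) * (L : ℝ) ^ 2 / 2⌋₊ : ℕ) : ℝ) ≤ (1 - δ) * (L : ℝ) ^ 2 := by
  have hx : 0 ≤ (1 - δ) * (L : ℝ) ^ 2 / 2 := by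
    have : (0 : ℝ) ≤ 1 - δ := by linarith
    positivity
  have h1 := Nat.floor_le hx
  have h2 := Nat.lt_floor_add_one ((1 - δ) * (L : ℝ) ^ 2 / 2)
  push_cast
  constructor <;> linarith

/-- **Source-free canonical/GC equivalence at the crux's own `μ`** from a supporting potential `μ'` and density
matching at `μ`: `E_sec(N_L) − μN_L − E₀(K_μ) ≤ εL²` eventually along even `L`. -/
theorem canonicalGCEquivalence_of_csp_of_densityMatched {U δ μ : ℝ} (hδ : δ ≤ 1)
    (hCSP : ∃ μ' : ℝ, ∀ ε : ℝ, 0 < ε → ∃ L₀ : ℕ, ∀ L : ℕ, Even L → L₀ ≤ L →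
      |(hubbardTorus 2 L 1 U).minEnergyOn (szSector (2 * ⌊(1 - δ) * (L : ℝ) ^ 2 / 2⌋₊) 0) -
          μ' * ((2 * ⌊(1 - δ) * (L : ℝ) ^ 2 / 2⌋₊ : ℕ) : ℝ) -
            Matrix.groundEnergy (hubbardTorusWith 2 L 1 U μ')| ≤ ε * (L : ℝ) ^ 2)
    (hDM : Filter.Tendsto (fun L : ℕ => ((hubbardTorusWith 2 (L + 1) 1 U μ).groundStateFunctional totalNumber).re / ((L + 1 : ℕ) : ℝ) ^ 2) Filter.atTop (nhds (1 - δ))) :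
    ∀ ε : ℝ, 0 < ε → ∃ L₀ : ℕ, ∀ L : ℕ, L₀ ≤ L → Even L →
      (hubbardTorus 2 L 1 U).minEnergyOn (szSector (2 * ⌊(1 - δ) * (L : ℝ) ^ 2 / 2⌋₊) 0) -
          μ * ((2 * ⌊(1 - δ) * (L : ℝ) ^ 2 / 2⌋₊ : ℕ) : ℝ) - (hubbardTorusWith 2 L 1 U μ).groundEnergy ≤
        ε * (L : ℝ) ^ 2 := by
  intro ε hε
  obtain ⟨μ', hμ'⟩ := hCSP
  set C : ℝ := |μ' - μ| with hC_def
  have hC : 0 ≤ C := abs_nonneg _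
  obtain ⟨L₁, hL₁⟩ := hμ' (ε / 2) (by positivity)
  set ε₂ : ℝ := ε / (4 * (C + 1)) with hε₂_def
  have hC1 : 0 < C + 1 := by linarith
  have hε₂ : 0 < ε₂ := by positivity
  obtain ⟨L₂, hL₂⟩ := Metric.tendsto_atTop.1 hDM ε₂ hε₂
  obtain ⟨L₃, hL₃⟩ := exists_nat_ge (2 / ε₂)
  refine ⟨max L₁ (max (L₂ + 1) (L₃ + 1)), fun L hL hev => ?_⟩
  have hL1 : L₁ ≤ L := le_of_max_le_left hL
  have hL2 : L₂ + 1 ≤ L := (le_max_left _ _).trans (le_of_max_le_right hL)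
  have hL3 : L₃ + 1 ≤ L := (le_max_right _ _).trans (le_of_max_le_right hL)
  obtain ⟨n, rfl⟩ : ∃ n, L = n + 1 := ⟨L - 1, by omega⟩
  set Lr : ℝ := ((n + 1 : ℕ) : ℝ) with hLr
  have hLr1 : 1 ≤ Lr := by rw [hLr]; exact_mod_cast (by omega : 1 ≤ n + 1)
  have hLpos : 0 < Lr := by linarith
  have hL2pos : (0 : ℝ) < Lr ^ 2 := by positivity
  have hd := hL₂ n (by omega)
  rw [Real.dist_eq] at hd
  set nL : ℝ := ((hubbardTorusWith 2 (n + 1) 1 U μ).groundStateFunctional totalNumber).re with hnL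
  have hd' : |nL - (1 - δ) * Lr ^ 2| < ε₂ * Lr ^ 2 := by
    have e : nL - (1 - δ) * Lr ^ 2 = (nL / Lr ^ 2 - (1 - δ)) * Lr ^ 2 := by
      field_simp
    rw [e, abs_mul, abs_of_pos hL2pos]
    exact mul_lt_mul_of_pos_right hd hL2pos
  obtain ⟨hN1, hN2⟩ := summitNumber_mem (n + 1) hδ
  have h2le : 2 ≤ ε₂ * Lr ^ 2 := by
    have hL3r : (L₃ : ℝ) ≤ Lr := by rw [hLr]; exact_mod_cast (by omega : L₃ ≤ n + 1)
    have h1 : 2 / ε₂ ≤ Lr := hL₃.trans hL3r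
    rw [div_le_iff₀ hε₂] at h1
    nlinarith
  have hcsp := (le_abs_self _).trans (hL₁ (n + 1) hev hL1)
  have hrec := canonical_gc_gap_recentre (n + 1) U μ μ'
    ((hubbardTorus 2 (n + 1) 1 U).minEnergyOn (szSector (2 * ⌊(1 - δ) * Lr ^ 2 / 2⌋₊) 0))
    (((2 * ⌊(1 - δ) * Lr ^ 2 / 2⌋₊ : ℕ) : ℝ))
  have habs : |((2 * ⌊(1 - δ) * Lr ^ 2 / 2⌋₊ : ℕ) : ℝ) - nL| ≤ 2 * ε₂ * Lr ^ 2 := by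
    rw [abs_le]
    obtain ⟨hd1, hd2⟩ := abs_lt.1 hd'
    constructor <;> linarith
  have hprod : (μ' - μ) * (((2 * ⌊(1 - δ) * Lr ^ 2 / 2⌋₊ : ℕ) : ℝ) - nL) ≤ C * (2 * ε₂ * Lr ^ 2) :=
    calc (μ' - μ) * (((2 * ⌊(1 - δ) * Lr ^ 2 / 2⌋₊ : ℕ) : ℝ) - nL)
        ≤ |(μ' - μ) * (((2 * ⌊(1 - δ) * Lr ^ 2 / 2⌋₊ : ℕ) : ℝ) - nL)| := le_abs_self _
      _ = C * |((2 * ⌊(1 - δ) * Lr ^ 2 / 2⌋₊ : ℕ) : ℝ) - nL| := by rw [abs_mul]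
      _ ≤ C * (2 * ε₂ * Lr ^ 2) := mul_le_mul_of_nonneg_left habs hC
  have hCε : C * (2 * ε₂) ≤ ε / 2 := by
    have e : C * (2 * ε₂) = ε / 2 * (C / (C + 1)) := by
      rw [hε₂_def]
      field_simp
      ring
    rw [e]
    have : C / (C + 1) ≤ 1 := (div_le_one hC1).2 (by linarith)
    nlinarith
  have hCε' : C * (2 * ε₂ * Lr ^ 2) ≤ ε / 2 * Lr ^ 2 := by nlinarith
  linarith

/-! ## Composition: the chord form of face purity from S1 + S2 + S4 + S5 + CGE -/

/-- Real bookkeeping of Transfer B on one side (`A = L²`): `Ehκ, Eh0` the sourced GC energies at block couplings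
`κ, 0`; `E0κ, E00` the source-free ones; `Sκ, S0` the sector energies of `H + κW_R`, `H` at `N_L`; `x` the sourced
tracial pair amplitude of the repelled model. Inputs in order: S1 (with `t = κ`), S2 (floor), S4 twice, S5, CGE,
the choice of `h`. Output: the chord floor `κ (a²/4) A ≤ Sκ − S0`. -/
theorem repelled_chord_arith {Ehκ Eh0 E0κ E00 Sκ S0 x A a κ h μN ε : ℝ}
    (hS1 : Eh0 - Ehκ ≤ -κ * x ^ 2 / A) (hS2 : a ≤ x / A) (ha : 0 < a) (hA : 0 < A) (hκ : 0 < κ)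
    (hS4a : |Ehκ - E0κ| ≤ 12 * h * A) (hS4b : |Eh0 - E00| ≤ 12 * h * A)
    (hS5 : E0κ ≤ Sκ - μN) (hcge : S0 - μN - E00 ≤ ε * A)
    (hh : 24 * (12 * h) ≤ κ * a ^ 2) (hε : ε = κ * a ^ 2 / 4) :
    κ * (a ^ 2 / 4) * A ≤ Sκ - S0 := by
  have hx : a * A ≤ x := (le_div_iff₀ hA).mp hS2
  have haA : 0 ≤ a * A := by positivity
  have hx2 : (a * A) ^ 2 ≤ x ^ 2 := pow_le_pow_left₀ haA hx 2
  have h1 : κ * a ^ 2 * A ≤ κ * x ^ 2 / A := by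
    rw [le_div_iff₀ hA]
    calc κ * a ^ 2 * A * A = κ * (a * A) ^ 2 := by ring
      _ ≤ κ * x ^ 2 := mul_le_mul_of_nonneg_left hx2 hκ.le
  have hneg : -κ * x ^ 2 / A = -(κ * x ^ 2 / A) := by ring
  have hgap : κ * a ^ 2 * A ≤ Ehκ - Eh0 := by
    rw [hneg] at hS1
    linarith
  have h4a := abs_le.mp hS4a
  have h4b := abs_le.mp hS4b
  have hhA : 24 * (12 * h) * A ≤ κ * a ^ 2 * A := mul_le_mul_of_nonneg_right hh hA.le
  subst hε
  linarith [h4a.1, h4a.2, h4b.1, h4b.2]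

/-- The odd numbers tend to infinity (used to pass from `∀ᶠ L, P (L+1)` to the even sides `2k+2`). -/
theorem tendsto_two_mul_add_one : Tendsto (fun k : ℕ => 2 * k + 1) atTop atTop := by
  refine tendsto_atTop_mono (fun k => ?_) tendsto_id
  simp only [id]; omega

/-- **Face purity, chord form, at every guarded `(U, δ, μ)`** (the twin line's promoted stub
`stub_facePurityChord`, displayed as CHORD(U, δ) of `Negative/FacePurityDissection.lean`), from S1, S2, S4, S5 and
the canonical/GC equivalence obtained from S3 by recentring. Floor `a²/4`, coupling `κ(R)` from S2. -/
theorem facePurityChord_of_stubs :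
    ∃ U₀ : ℝ, 0 < U₀ ∧ ∀ U ∈ Set.Ioo (0:ℝ) U₀, ∀ δ ∈ Set.Ioo (0:ℝ) (1 / 2), ∀ μ : ℝ, Filter.Tendsto (fun L : ℕ => ((hubbardTorusWith 2 (L + 1) 1 U μ).groundStateFunctional totalNumber).re / ((L + 1 : ℕ) : ℝ) ^ 2) Filter.atTop (nhds (1 - δ)) → HasDWaveOrder U μ → (∃ a : ℝ, 0 < a ∧ ∀ R : ℕ, 0 < R → ∃ κ : ℝ, 0 < κ ∧ ∀ᶠ k : ℕ in Filter.atTop,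
    κ * a * ((2 * k + 1 + 1 : ℕ) : ℝ) ^ 2 ≤
      (hubbardTorus 2 (2 * k + 1 + 1) 1 U + (κ : ℂ) • (((((R : ℝ) ^ 4)⁻¹ : ℝ) : ℂ) • ∑ a : Literature.Probability.LatticeModels.TorusSite 2 (2 * k + 1 + 1), ((∑ u : Fin 2 → Fin R, localPair dWaveFormFactor ((2 * k + 1 + 1)) (a + fun i => ((u i : ℕ) : ZMod ((2 * k + 1 + 1))))))ᴴ * ((∑ u : Fin 2 → Fin R, localPair dWaveFormFactor ((2 * k + 1 + 1)) (a + fun i => ((u i : ℕ) : ZMod ((2 * k + 1 + 1)))))))).minEnergyOn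
          (szSector (2 * ⌊(1 - δ) * (((2 * k + 1 + 1) : ℕ) : ℝ) ^ 2 / 2⌋₊) 0) -
        (hubbardTorus 2 (2 * k + 1 + 1) 1 U).minEnergyOn (szSector (2 * ⌊(1 - δ) * (((2 * k + 1 + 1) : ℕ) : ℝ) ^ 2 / 2⌋₊) 0)) := by
  obtain ⟨U₀, hU₀, hB⟩ := stub_repelledOrderPersistence
  refine ⟨U₀, hU₀, fun U hU δ hδ μ hdm hord => ?_⟩
  obtain ⟨a, ha, hBa⟩ := hB U hU δ hδ μ hdm hord
  have hδ1 : δ ≤ 1 := by linarith [hδ.2]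
  have hδ0 : 0 ≤ δ := hδ.1.le
  have hcge := canonicalGCEquivalence_of_csp_of_densityMatched (U := U) (μ := μ) hδ1
    (stub_canonicalSupportingPotential U δ ⟨hδ.1, by linarith [hδ.2]⟩) hdm
  refine ⟨a ^ 2 / 4, by positivity, fun R hR => ?_⟩
  obtain ⟨κ, hκ, h₀, hh₀, hBκ⟩ := hBa R hR
  refine ⟨κ, hκ, ?_⟩
  -- the source strength
  set h : ℝ := min (h₀ / 2) (κ * a ^ 2 / 288) with hh_def
  have hhpos : 0 < h := lt_min (by positivity) (by positivity)
  have hhIoo : h ∈ Set.Ioo (0:ℝ) h₀ := ⟨hhpos, lt_of_le_of_lt (min_le_left _ _) (by linarith)⟩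
  have hh288 : 24 * (12 * h) ≤ κ * a ^ 2 := by
    have : h ≤ κ * a ^ 2 / 288 := min_le_right _ _
    linarith
  -- S2 on the even sides, CGE at resolution κa²/4
  have hBk := tendsto_two_mul_add_one.eventually (hBκ h hhIoo)
  obtain ⟨L₁, hL₁⟩ := hcge (κ * a ^ 2 / 4) (by positivity)
  filter_upwards [hBk, eventually_ge_atTop L₁] with k hk hkL
  have hEven : Even (2 * k + 1 + 1) := ⟨k + 1, by ring⟩
  have hL₁' : L₁ ≤ 2 * k + 1 + 1 := by omega
  have hcgek := hL₁ (2 * k + 1 + 1) hL₁' hEven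
  -- S1 with base point κ and step t = κ
  have hS1 := stub_blockSlope (2 * k + 1 + 1) R hR U μ h κ κ hκ.le
  rw [sub_self, Complex.ofReal_zero, zero_smul, add_zero] at hS1
  -- S4 at κ and at 0
  have hS4a := stub_sourceRemoval (2 * k + 1 + 1) R U μ h κ
  have hS4b := stub_sourceRemoval (2 * k + 1 + 1) R U μ h 0
  rw [Complex.ofReal_zero, zero_smul, add_zero, add_zero] at hS4b
  rw [abs_of_pos hhpos] at hS4a hS4b
  -- S5 in the sector N_L (non-empty)
  have hne : ∃ φ : Fock (Orb (FermionTorus 2 (2 * k + 1 + 1))),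
      φ ∈ szSector (2 * ⌊(1 - δ) * (((2 * k + 1 + 1 : ℕ) : ℝ)) ^ 2 / 2⌋₊) 0 ∧ φ ≠ 0 := by
    obtain ⟨ψ, -, hψ⟩ := exists_unit_groundStateInSector (2 * k + 1 + 1) U
      (halfFilling_floor_le_sq (2 * k + 1 + 1) hδ0)
    exact ⟨ψ, hψ.1, hψ.2.1⟩
  have hS5 := stub_sectorFloorGC (2 * k + 1 + 1) R U μ κ _ hne
  have hA : (0 : ℝ) < (((2 * k + 1 + 1 : ℕ) : ℝ)) ^ 2 := by positivity
  exact repelled_chord_arith hS1 hk ha hA hκ hS4a hS4b hS5 hcgek hh288 rfl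

/-! ## The skeleton theorem -/

/-- **The skeleton theorem (v1).** The five stubs (sorries only in `stub_*`), the EXISTING route item
stmt-HubbardSuperconductivity-1089 `KacWindowPenalty.WindowInfraredBound` (admissible hypothesis BY NAME, as in both
twin lines) and the twin's LANDED dissection/Fejér/kernel files conclude the crux `CwSsbToEvenTorusLRO` BY NAME. -/
theorem CwSsbToEvenTorusLRO_of
    (hW : Summit.HubbardSuperconductivity.HubbardSuperconductivity.Theses.KacWindowPenalty.WindowInfraredBound) :
    Summit.HubbardSuperconductivity.HubbardSuperconductivity.Theses.ChiralWindow.CwSsbToEvenTorusLRO := by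
  obtain ⟨U₀, hU₀, hP⟩ := facePurityChord_of_stubs
  refine ⟨U₀, hU₀, fun U hU δ hδ μ hdm hord => ?_⟩
  have hderiv := deriv_of_chord (hP U hU δ hδ μ hdm hord)
  have hleak := leak_of_windowInfraredBound hW hU.1 hδ
  exact hasDWavePairFieldLROAt_of_floor (floor_of_deriv_of_leak hderiv hleak)

end Summit.HubbardSuperconductivity.HubbardSuperconductivity.Cruxes.CwSsbToEvenTorusLRO.GriffithsBlockSlope

end
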